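import Summits.HodgeConjecture.HodgeConjecture.Theorems.MarkmanPartnerTransportRMComponentDefs
import Summits.HodgeConjecture.HodgeConjecture.Theorems.MarkmanPartnerTransportPicardThreeK3SquaresRMSpreadOfCycleInduced

/-!
# Route MarkmanPartnerTransport · cruxes #4 / #5 — the displayed Prop `RMTypeDominated θ` at `θ = 0`:
# a PROVABLE instance (vacuity hygiene for the line «RM-type descent»)

The displayed moduli input `RMTypeDominated θ` (`Theorems/MarkmanPartnerTransportRMTypeDefs`, planner
p1 g36) quantifies over all marked projective K3 surfaces with `θ`-eigen, `θ`-generic period and asks an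
`RMSpreadFamily` for the transported endomorphism `η'⁻¹ ∘ θ_ℂ ∘ η'`. Referee hodge-nonav-ref (A46-3,
A4) noted that the degenerate instance `θ = 0` is admissible and harmless: the transported endomorphism
is `0`, which is induced by the ZERO cycle, so the constant family of
`nonempty_rmSpreadFamily_of_exists_algebraicClass` (p611064: `(S ⊗ S) × ℙ¹ → ℙ¹`) inhabits the
structure. This file records that instance as a theorem — the binders of the Prop CAN be met and its
shape is dischargeable by the tree's own constructor (no moduli input needed at `θ = 0`):

* `thetaC_zero` — `θ_ℂ = 0` for `θ = 0`;
* `rmTypeDominated_zero : RMTypeDominated 0`;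
* `nonempty_rmSpreadFamily_zero`, `exists_rmComponentFamily_induces_zero` — via the lossless split
  (I1′ + I2) `RMComponentFamily.nonempty_rmSpreadFamily_iff`, the same instance inhabits
  `∃ F, F.Induces hS 0 ∧ F.IsDominatedByCycles` for every smooth projective surface `S`.

Nothing here bears on the open types `θ₉`, `θ₁₁`, `θ√2`; it only certifies that the displayed Prop is
not vacuously unsatisfiable in its binder structure. No definition, no sorry, no named fact. Prover seat
hodge-nonav-19652-p1 (gen 8), `--supports stmt-HodgeConjecture-19652`.

References: van Geemen–Schütt, Forum Math. Sigma 13 (2025) e2, §3.4; Voisin, *Hodge Theory II*, §5.3.1.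
-/

set_option linter.dupNamespace false

noncomputable section

namespace Summit.HodgeConjecture.HodgeConjecture.Theorems.MarkmanPartnerTransport

open CategoryTheory MonoidalCategory CartesianMonoidalCategory AlgebraicGeometry
open Literature.AlgebraicGeometry Literature.AlgebraicGeometry.Motives Literature.AlgebraicGeometry.HodgeTheory
open Literature.AlgebraicGeometry.Surfaces
open Literature.AlgebraicTopology.SingularHomology

/-- `θ_ℂ = 0` for the zero model endomorphism. [folklore] -/
theorem thetaC_zero : thetaC 0 = 0 := by
  unfold thetaC
  rw [Matrix.map_zero _ (map_zero _)]
  exact map_zero _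

/-- **Every smooth projective surface carries a spread family for the ZERO endomorphism** (the constant
family with the zero class: `nonempty_rmSpreadFamily_of_exists_algebraicClass` with `γ = 0`).
[cite: GeemenSchutt2023, §3.4] [cite: VoisinHodgeII2003, §5.3.1] -/
theorem nonempty_rmSpreadFamily_zero {S : SchemeOver ℂ} (hS : IsSmoothProjective 2 S) :
    Nonempty (RMSpreadFamily S hS 0) :=
  nonempty_rmSpreadFamily_of_exists_algebraicClass hS 0
    ⟨0, Submodule.zero_mem _, fun y ↦ by rw [LinearMap.zero_apply, map_zero, map_zero]⟩

/-- **`RMTypeDominated 0` holds** — the degenerate instance of the displayed moduli input: the transported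
endomorphism `η'⁻¹ ∘ 0 ∘ η'` is `0`, inhabited by the constant family with the zero cycle. Certifies that
the binder structure of the Prop is dischargeable (referee A46-3 (A4)); says nothing about `θ ≠ 0`.
[cite: GeemenSchutt2023, §3.4] -/
theorem rmTypeDominated_zero : RMTypeDominated 0 := by
  intro S' hS' η' _ _ _ _ _ _ _
  have h0 : (η'.symm.toLinearMap ∘ₗ (thetaC 0 ∘ₗ η'.toLinearMap)) = 0 := by
    rw [thetaC_zero, LinearMap.zero_comp, LinearMap.comp_zero]
  rw [h0]
  exact nonempty_rmSpreadFamily_zero hS'.isSmoothProjective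

/-- **The split form at `θ = 0`**: every smooth projective surface lies on a component family inducing the
zero endomorphism and dominated by cycles (the same constant family, through the lossless split
`RMComponentFamily.nonempty_rmSpreadFamily_iff`). [cite: GeemenSchutt2023, §3.4] -/
theorem exists_rmComponentFamily_induces_zero {S : SchemeOver ℂ} (hS : IsSmoothProjective 2 S) :
    ∃ F : RMComponentFamily, F.Induces hS 0 ∧ F.IsDominatedByCycles :=
  (RMComponentFamily.nonempty_rmSpreadFamily_iff hS 0).1 (nonempty_rmSpreadFamily_zero hS)

end Summit.HodgeConjecture.HodgeConjecture.Theorems.MarkmanPartnerTransport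

end
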